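import Mathlib

/-!
# SoloBlindChordCover — soundness of the vertical inner-chord cover certificate (gen104 cover audit)

The a-posteriori cover audit of the regime-(II) pieces (`cover_audit2.py`) certifies that a rectangle
`[x₁, x₂] × [a, b]` lies in a union of discs by a *vertical chord sweep*: on the u-cell `[x₁, x₂]` every disc
with centre `(u₀, c)` and radius `r` contributes its INNER chord `[c - w, c + w]`, `w = √(r² - d²)`,
`d = max |x₁ - u₀| |x₂ - u₀|` (valid for every `u` in the cell), and the chords must cover `[a, b]`.
This file proves that certificate shape sound, including the γ-scaled ("straight", physical-coordinate)
discs `(u/γ - x₀)² + (v/γ - y₀)² ≤ ρ²` used for a whole interval of scale factors `γ ∈ [γa, γb]`, whose chord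
in `v` is the intersection over `γ` of `γ • [y₀ - w, y₀ + w]`, computed from the endpoint values only.
Pure real algebra; no analysis beyond `Real.sqrt`.
-/

namespace Summit.AnomalousDissipation.SoloBlind.ChordCover

/-- On a cell `x₁ ≤ u ≤ x₂` the horizontal distance to `u₀` is at most the larger endpoint distance. -/
theorem abs_sub_le_max_of_mem {x₁ x₂ u u₀ : ℝ} (h₁ : x₁ ≤ u) (h₂ : u ≤ x₂) :
    |u - u₀| ≤ max |x₁ - u₀| |x₂ - u₀| := by
  rcases le_total u u₀ with h | h
  · have : |u - u₀| ≤ |x₁ - u₀| := by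
      rw [abs_of_nonpos (by linarith), abs_of_nonpos (by linarith)]; linarith
    exact this.trans (le_max_left _ _)
  · have : |u - u₀| ≤ |x₂ - u₀| := by
      rw [abs_of_nonneg (by linarith), abs_of_nonneg (by linarith)]; linarith
    exact this.trans (le_max_right _ _)

/-- INNER CHORD: if `d` bounds the horizontal distance on the cell and `w² + d² ≤ r²`, then every point of the
cell with `|v - c| ≤ w` lies in the closed disc of radius `r` about `(u₀, c)`. -/
theorem mem_disc_of_chord {x₁ x₂ u v u₀ c r d w : ℝ} (h₁ : x₁ ≤ u) (h₂ : u ≤ x₂)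
    (hd : max |x₁ - u₀| |x₂ - u₀| ≤ d) (hw : 0 ≤ w) (hr : w ^ 2 + d ^ 2 ≤ r ^ 2) (hv : |v - c| ≤ w) :
    (u - u₀) ^ 2 + (v - c) ^ 2 ≤ r ^ 2 := by
  have hu : |u - u₀| ≤ d := (abs_sub_le_max_of_mem h₁ h₂).trans hd
  have hd0 : 0 ≤ d := (abs_nonneg _).trans hu
  have e1 : (u - u₀) ^ 2 ≤ d ^ 2 := sq_le_sq.mpr (by rw [abs_of_nonneg hd0]; exact hu)
  have e2 : (v - c) ^ 2 ≤ w ^ 2 := sq_le_sq.mpr (by rw [abs_of_nonneg hw]; exact hv)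
  linarith

/-- The engine's chord half-width `w = √((r - d)(r + d))` satisfies `w² + d² ≤ r²` when `d ≤ r` (and `0 ≤ d`). -/
theorem sqrt_chord_sq {r d : ℝ} (hd : 0 ≤ d) (hdr : d ≤ r) :
    (Real.sqrt ((r - d) * (r + d))) ^ 2 + d ^ 2 ≤ r ^ 2 := by
  have hnn : 0 ≤ (r - d) * (r + d) := mul_nonneg (by linarith) (by linarith)
  rw [Real.sq_sqrt hnn]; nlinarith

/-- A shrunken chord is still a chord: `w' ≤ w` keeps `w'² + d² ≤ r²`. -/
theorem chord_shrink {r d w w' : ℝ} (hw' : 0 ≤ w') (hle : w' ≤ w) (h : w ^ 2 + d ^ 2 ≤ r ^ 2) :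
    w' ^ 2 + d ^ 2 ≤ r ^ 2 := by
  have : w' ^ 2 ≤ w ^ 2 := sq_le_sq.mpr (by rw [abs_of_nonneg hw', abs_of_nonneg (hw'.trans hle)]; exact hle)
  linarith

/-- CELL CERTIFICATE: a finite family of discs `i : ι` with chord data `(c i, w i, d i)` on the cell `[x₁, x₂]`;
if every `v ∈ [a, b]` is within `w i` of some `c i`, the whole cell `× [a, b]` is covered by the discs. -/
theorem cell_covered {ι : Type*} {x₁ x₂ a b : ℝ} (u₀ c r d w : ι → ℝ)
    (hd : ∀ i, max |x₁ - u₀ i| |x₂ - u₀ i| ≤ d i) (hw : ∀ i, 0 ≤ w i) (hr : ∀ i, w i ^ 2 + d i ^ 2 ≤ r i ^ 2)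
    (hcov : ∀ v, a ≤ v → v ≤ b → ∃ i, |v - c i| ≤ w i) :
    ∀ u v, x₁ ≤ u → u ≤ x₂ → a ≤ v → v ≤ b → ∃ i, (u - u₀ i) ^ 2 + (v - c i) ^ 2 ≤ r i ^ 2 := by
  intro u v h₁ h₂ ha hb
  obtain ⟨i, hi⟩ := hcov v ha hb
  exact ⟨i, mem_disc_of_chord h₁ h₂ (hd i) (hw i) (hr i) hi⟩

/-- A linear function of `γ` on `[γa, γb]` is bounded by its endpoint values. -/
theorem mul_le_max_endpoints {γa γb γ t : ℝ} (ha : γa ≤ γ) (hb : γ ≤ γb) :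
    γ * t ≤ max (γa * t) (γb * t) := by
  rcases le_total 0 t with ht | ht
  · exact (mul_le_mul_of_nonneg_right hb ht).trans (le_max_right _ _)
  · exact (mul_le_mul_of_nonpos_right ha ht).trans (le_max_left _ _)

/-- A linear function of `γ` on `[γa, γb]` is bounded below by the smaller endpoint value. -/
theorem min_endpoints_le_mul {γa γb γ t : ℝ} (ha : γa ≤ γ) (hb : γ ≤ γb) :
    min (γa * t) (γb * t) ≤ γ * t := by
  rcases le_total 0 t with ht | ht
  · exact (min_le_left _ _).trans (mul_le_mul_of_nonneg_right ha ht)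
  · exact (min_le_right _ _).trans (mul_le_mul_of_nonpos_right hb ht)

/-- γ-INTERSECTION CHORD: if `v` lies in `[max (γa lo) (γb lo), min (γa hi) (γb hi)]` then `v/γ ∈ [lo, hi]` for every
`γ ∈ [γa, γb]` with `0 < γ` — the audit's v-chord of a physical-coordinate disc valid for a whole γ-interval. -/
theorem div_mem_of_inter_chord {γa γb γ lo hi v : ℝ} (hγ : 0 < γ) (ha : γa ≤ γ) (hb : γ ≤ γb)
    (hlo : max (γa * lo) (γb * lo) ≤ v) (hhi : v ≤ min (γa * hi) (γb * hi)) :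
    lo ≤ v / γ ∧ v / γ ≤ hi := by
  constructor
  · rw [le_div_iff₀ hγ, mul_comm]; exact (mul_le_max_endpoints ha hb).trans hlo
  · rw [div_le_iff₀ hγ, mul_comm]; exact hhi.trans (min_endpoints_le_mul ha hb)

/-- The quotient `u/γ` over a cell `u ∈ [x₁, x₂]` and `γ ∈ [γa, γb]`, `0 < γa`, stays between the extreme corner
quotients, hence its distance to `x₀` is bounded by the larger corner distance (the audit's `d` for straight discs). -/
theorem abs_div_sub_le_corners {γa γb γ x₁ x₂ u x₀ : ℝ} (hγa : 0 < γa) (ha : γa ≤ γ) (hb : γ ≤ γb)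
    (h₁ : x₁ ≤ u) (h₂ : u ≤ x₂) :
    |u / γ - x₀| ≤ max |min (min (x₁ / γa) (x₁ / γb)) (min (x₂ / γa) (x₂ / γb)) - x₀|
                     |max (max (x₁ / γa) (x₁ / γb)) (max (x₂ / γa) (x₂ / γb)) - x₀| := by
  have hγ : 0 < γ := lt_of_lt_of_le hγa ha
  have hγb : 0 < γb := lt_of_lt_of_le hγ hb
  -- u/γ lies between min and max of the four corner quotients
  have lo_le : min (min (x₁ / γa) (x₁ / γb)) (min (x₂ / γa) (x₂ / γb)) ≤ u / γ := by
    -- x₁/γ ≤ u/γ and x₁/γ ≥ min (x₁/γa) (x₁/γb)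
    have h1 : x₁ / γ ≤ u / γ := div_le_div_of_nonneg_right h₁ hγ.le
    have h2 : min (x₁ / γa) (x₁ / γb) ≤ x₁ / γ := by
      rcases le_total 0 x₁ with hx | hx
      · exact (min_le_right _ _).trans (div_le_div_of_nonneg_left hx hγ hb)
      · exact (min_le_left _ _).trans (by
          rw [div_le_div_iff₀ hγa hγ]; nlinarith)
    exact ((min_le_left _ _).trans h2).trans h1
  have le_hi : u / γ ≤ max (max (x₁ / γa) (x₁ / γb)) (max (x₂ / γa) (x₂ / γb)) := by
    have h1 : u / γ ≤ x₂ / γ := div_le_div_of_nonneg_right h₂ hγ.le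
    have h2 : x₂ / γ ≤ max (x₂ / γa) (x₂ / γb) := by
      rcases le_total 0 x₂ with hx | hx
      · exact (div_le_div_of_nonneg_left hx hγa ha).trans (le_max_left _ _)
      · exact (le_max_right _ _).trans' (by
          rw [div_le_div_iff₀ hγ hγb]; nlinarith)
    exact h1.trans (h2.trans (le_max_right _ _))
  exact abs_sub_le_max_of_mem lo_le le_hi

/-- STRAIGHT-DISC CHORD (the audit's `SHEAR=0` branch): for a physical-coordinate disc `(u/γ - x₀)² + (v/γ - y₀)² ≤ ρ²`,
if `d` bounds `|u/γ - x₀|` on the cell for all admissible `γ`, `w ≥ 0`, `w² + d² ≤ ρ²`, and `v` lies in the γ-intersection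
chord of `[y₀ - w, y₀ + w]`, then `(u, v)` is in the disc for every `γ ∈ [γa, γb]`. -/
theorem mem_scaled_disc_of_chord {γa γb γ u v x₀ y₀ ρ d w : ℝ} (hγ : 0 < γ) (ha : γa ≤ γ) (hb : γ ≤ γb)
    (hd : |u / γ - x₀| ≤ d) (hw : 0 ≤ w) (hr : w ^ 2 + d ^ 2 ≤ ρ ^ 2)
    (hlo : max (γa * (y₀ - w)) (γb * (y₀ - w)) ≤ v) (hhi : v ≤ min (γa * (y₀ + w)) (γb * (y₀ + w))) :
    (u / γ - x₀) ^ 2 + (v / γ - y₀) ^ 2 ≤ ρ ^ 2 := by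
  obtain ⟨h1, h2⟩ := div_mem_of_inter_chord hγ ha hb hlo hhi
  have hv : |v / γ - y₀| ≤ w := abs_le.mpr ⟨by linarith, by linarith⟩
  have hd0 : 0 ≤ d := (abs_nonneg _).trans hd
  have e1 : (u / γ - x₀) ^ 2 ≤ d ^ 2 := sq_le_sq.mpr (by rw [abs_of_nonneg hd0]; exact hd)
  have e2 : (v / γ - y₀) ^ 2 ≤ w ^ 2 := sq_le_sq.mpr (by rw [abs_of_nonneg hw]; exact hv)
  linarith

/-- SIMILARITY (the audit's `SHEAR=1` mapping of a child disc into the top-level coordinates): scaling both coordinates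
and the radius by the same factor `f > 0` maps the disc onto a disc — membership is equivalent. -/
theorem mem_disc_scale_iff {f u v u₀ c r : ℝ} (hf : 0 < f) :
    (u - f * u₀) ^ 2 + (v - f * c) ^ 2 ≤ (f * r) ^ 2 ↔ (u / f - u₀) ^ 2 + (v / f - c) ^ 2 ≤ r ^ 2 := by
  have e1 : u - f * u₀ = f * (u / f - u₀) := by field_simp
  have e2 : v - f * c = f * (v / f - c) := by field_simp
  rw [e1, e2, mul_pow, mul_pow, mul_pow, ← mul_add]
  exact ⟨fun h => le_of_mul_le_mul_left h (pow_pos hf 2), fun h => mul_le_mul_of_nonneg_left h (pow_pos hf 2).le⟩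

end Summit.AnomalousDissipation.SoloBlind.ChordCover
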